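import Literature.Topology.FourManifolds.LinkGaussDiagramsRelabel
import Literature.Analysis.TotalPositivity.FeketeCriterion
import HarnessLib

/-!
# Reidemeister moves on Gauss diagrams of oriented links (link tower, step 0 of invariance)

The knot tower (`GaussDiagrams`, `GaussDiagramsRMoves`) writes the oriented Reidemeister moves
on `GaussDiagram` (ONE based circle, positions `Fin (2n)` in cyclic order) with `insertChord`
(`Fin.succAbove` renumbering), `braidMove` and the relations `PolyakMove`/`RMove`/`REquiv`, and
proves Khovanov–Lee–Rasmussen invariance move by move (`KhCurl*`, `KhBigon*`, `KhAntiBigon*`,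
`KhTriangle*`, `KhPolyakMove`). The link tower (`LinkGaussDiagrams` → … →
`LinkGaussDiagramsRelabel`) had no Reidemeister moves; this file defines them, mirroring the
knot tower with "`q + 1`" replaced by "`next q`".

**Design: splice, do not renumber.** The traversal of a link diagram is the permutation
`next`, so a new chord simply takes the NEW numbers `2n` (`newOver n`, its over-passage) and
`2n + 1` (`newUnder n`, its under-passage), an old point `q` keeps its number (`padPos q`), and
a move only rewires `next`: a new point `e` is spliced right after a point `r` by
`next ↦ next * swap r e` (`r ↦ e ↦ old next r`, the formula of `LinkGaussDiagram.saddle`).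
Everything is built from one reducible primitive `insertChord P Q ε` (splice `newOver n` after
`P`, then `newUnder n` after `Q`), so that chord data, bijectivity, naturality under relabelling
(`insertChord_relabel`) and the comparison with the knot tower (`ofGaussDiagram_insertChord`)
are proved once.

**Conventions** (`o`, `u` = over-, under-passage; chords point over → under and a crossing is
positive iff (over-tangent, under-tangent) is a positive basis, as in the knot tower; oriented
types as in Polyak (2010), §1, Figs 1–2). Constructors of `RMove`:
* `kink L p true ε` : `insertKink`, `p → o → u → next p` — `Ω1a–d` entered along the
  over-strand = `PolyakMove.omega1a` (`ofGaussDiagram_omega1a`); `kink L p false ε` :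
  `p → u → o → next p` = `PolyakMove.omega1b` (`ofGaussDiagram_omega1b`); `kinkFree` : `Ω1`
  on a chord-free circle (= `omega1a/b` on `GaussDiagram.empty`, sanity check below);
* `bigon L p q true ε` : `insertBigon`, chords `x` (sign `ε`), `y` (sign `-ε`), over-strand
  `p → o x → o y`, under-strand `q → u x → u y` — co-oriented, `Ω2a/Ω2b` =
  `PolyakMove.omega2a` (`o y = o x + 1`, `u y = u x + 1`); `bigon L p q false ε` : under-strand
  `q → u y → u x` — anti-parallel, `Ω2c/Ω2d` = `RMove.omega2c` (`u x = u y + 1`); both by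
  `rMove_omega2`; `bigonBehind` : the same inside one arc, under-passages behind;
* `triangle L x y z` : `braidMove` under `next (o x) = o y`, `next (u x) = o z`,
  `next (u y) = u z`, signs `+1` — the positive braid-like `Ω3b` = `PolyakMove.omega3a` (sic)
  (`rMove_ofGaussDiagram_omega3a`); `relabel` : `IsRelabelling` = `PolyakMove.relabel`.
The move set contains Polyak's generating set `{Ω1a, Ω1b, Ω2c, Ω2d, Ω3b}` (Polyak (2010),
Thm. 1.2); `REquiv := Relation.EqvGen RMove`, as `GaussDiagram.REquiv`.

**The knot tower inside.** `ofGaussDiagram_insertChord` (one `GaussDiagram.insertChord` is one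
`insertChord` up to the relabelling `knotPerm`, given the successor check), whence
`rEquiv_ofGaussDiagram_omega1a/omega1b` (ALL instances of the knot tower's `Ω1`, `G.n ≠ 0`),
`rMove_ofGaussDiagram_omega3a`, `rMove_ofGaussDiagram_relabel`, and for `Ω2`
`isRelabelling_insertBigon_ofGaussDiagram` + `rMove_omega2`: the link bigon between arcs
`p ≠ q` of a knot diagram IS an instance of `omega2a` (parallel) / `omega2c` (anti-parallel) up
to relabelling. NOT here: the converse bookkeeping that EVERY instance `(o, u, o', u')` of
`omega2a/omega2c` is a link bigon (case analysis on the gaps of the four new points, cf.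
`KhBigonRotate.omega2a_params`), hence no blanket `GaussDiagram.RMove G G' → REquiv …` yet;
`Ω2` with chord-free circles (to be added with `free - 1`, like `insertKinkFree`); the
checkerboard lemma for bigons (needs `c q = !c p`, resp. `c q = c p`); and the caveat
`ofGaussDiagram GaussDiagram.empty = unknots 0` (no arc, no free circle, no move) of
`LinkKhResolutions` persists — the crossingless unknot of the link tower is `unknots 1`.

**Follow-up files** (Reidemeister invariance of `frobeniusHomology`, `khovanovHomology`,
`rasmussenInvariant` in the link tower): `LinkKhCurl` (`insertKink`, port of `KhCurl*`),
`LinkKhBigon`/`LinkKhAntiBigon` (`insertBigon _ _ true/false`, `insertBigonBehind`; ports of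
`KhBigon*`, `KhAntiBigon*`), `LinkKhTriangle` (`braidMove`, port of `KhTriangle*`), `LinkKhRMove`.

## References

* M. Polyak, *Minimal generating sets of Reidemeister moves*, Quantum Topol. 1 (2010)
  399–411, §1 (Figs 1–2), Thm. 1.2, §2. [cite: Polyak2010, §2]
* M. Goussarov, M. Polyak, O. Viro, *Finite-type invariants of classical and virtual knots*,
  Topology 39 (2000) 1045–1068, §1, Fig. 3. [cite: GPV2000, §1]
* L. H. Kauffman, *Virtual knot theory*, European J. Combin. 20 (1999), §3.2 (Gauss codes,
  parity). [cite: Kauffman1999, §3.2]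
* J. Rasmussen, *Khovanov homology and the slice genus*, Invent. Math. 182 (2010), Lemma 2.4
  (checkerboard colourings). [cite: Rasmussen2010, §2.3]
-/

open Function

noncomputable section

namespace Literature.Topology.FourManifolds

namespace LinkGaussDiagram

variable (L : LinkGaussDiagram)

/-! ## New and old marked points; padding permutations -/

/-- The old marked point `q` of a diagram with `m` chords, as a point of the diagram with one
more chord (same number; the two new points are `2m`, `2m + 1`). [folklore] -/
def padPos {m : ℕ} (q : Fin (2 * m)) : Fin (2 * (m + 1)) := ⟨q, by omega⟩

/-- The value of a padded point. [folklore] -/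
@[simp] theorem val_padPos {m : ℕ} (q : Fin (2 * m)) : (padPos q : ℕ) = q := rfl

/-- Padding points is injective. [folklore] -/
@[simp] theorem padPos_inj {m : ℕ} {p q : Fin (2 * m)} : padPos p = padPos q ↔ p = q := by
  simp [Fin.ext_iff]

/-- The new marked point `2n`: the OVER-passage of the chord added to a diagram with `n`
chords. [folklore] -/
def newOver (n : ℕ) : Fin (2 * (n + 1)) := ⟨2 * n, by omega⟩

/-- The new marked point `2n + 1`: the UNDER-passage of the added chord. [folklore] -/
def newUnder (n : ℕ) : Fin (2 * (n + 1)) := ⟨2 * n + 1, by omega⟩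

/-- The value of `newOver n` is `2n`. [folklore] -/
@[simp] theorem val_newOver (n : ℕ) : (newOver n : ℕ) = 2 * n := rfl

/-- The value of `newUnder n` is `2n + 1`. [folklore] -/
@[simp] theorem val_newUnder (n : ℕ) : (newUnder n : ℕ) = 2 * n + 1 := rfl

/-- An old marked point is not the new over-passage. [folklore] -/
@[simp] theorem padPos_ne_newOver {m : ℕ} (q : Fin (2 * m)) : padPos q ≠ newOver m :=
  fun h ↦ by have := congrArg Fin.val h; simp at this; omega

/-- An old marked point is not the new under-passage. [folklore] -/
@[simp] theorem padPos_ne_newUnder {m : ℕ} (q : Fin (2 * m)) : padPos q ≠ newUnder m :=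
  fun h ↦ by have := congrArg Fin.val h; simp at this; omega

/-- The new over-passage is not an old marked point. [folklore] -/
@[simp] theorem newOver_ne_padPos {m : ℕ} (q : Fin (2 * m)) : newOver m ≠ padPos q :=
  (padPos_ne_newOver q).symm

/-- The new under-passage is not an old marked point. [folklore] -/
@[simp] theorem newUnder_ne_padPos {m : ℕ} (q : Fin (2 * m)) : newUnder m ≠ padPos q :=
  (padPos_ne_newUnder q).symm

/-- The two new marked points are distinct. [folklore] -/
@[simp] theorem newOver_ne_newUnder (m : ℕ) : newOver m ≠ newUnder m :=
  fun h ↦ by have := congrArg Fin.val h; simp at this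

/-- The two new marked points are distinct. [folklore] -/
@[simp] theorem newUnder_ne_newOver (m : ℕ) : newUnder m ≠ newOver m :=
  (newOver_ne_newUnder m).symm

/-- Every marked point of the enlarged diagram is an old point or one of the two new points.
[folklore] -/
theorem cases_pos {m : ℕ} (x : Fin (2 * (m + 1))) :
    (∃ q : Fin (2 * m), x = padPos q) ∨ x = newOver m ∨ x = newUnder m := by
  by_cases h : (x : ℕ) < 2 * m
  · exact .inl ⟨⟨x, h⟩, Fin.ext rfl⟩
  · by_cases h' : (x : ℕ) = 2 * m
    · exact .inr (.inl (Fin.ext h'))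
    · exact .inr (.inr (Fin.ext (by simp; omega)))

/-- The old points as an equivalence onto the points below `2m`. [folklore] -/
def padEquiv (m : ℕ) : Fin (2 * m) ≃ {x : Fin (2 * (m + 1)) // (x : ℕ) < 2 * m} :=
  ⟨fun q ↦ ⟨padPos q, q.isLt⟩, fun x ↦ ⟨x.1, x.2⟩, fun _ ↦ rfl, fun _ ↦ rfl⟩

/-- **Padding a permutation** of the `2m` old points by the identity on the two new points
(`Equiv.Perm.extendDomain`). [folklore] -/
def padPerm {m : ℕ} (σ : Equiv.Perm (Fin (2 * m))) : Equiv.Perm (Fin (2 * (m + 1))) :=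
  σ.extendDomain (padEquiv m)

/-- A padded permutation acts on the old points by `σ`. [folklore] -/
@[simp] theorem padPerm_padPos {m : ℕ} (σ : Equiv.Perm (Fin (2 * m))) (q : Fin (2 * m)) :
    padPerm σ (padPos q) = padPos (σ q) :=
  σ.extendDomain_apply_image (padEquiv m) q

/-- Padded permutations fix the new over-passage. [folklore] -/
@[simp] theorem padPerm_newOver {m : ℕ} (σ : Equiv.Perm (Fin (2 * m))) :
    padPerm σ (newOver m) = newOver m :=
  σ.extendDomain_apply_not_subtype (padEquiv m) (by simp)

/-- Padded permutations fix the new under-passage. [folklore] -/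
@[simp] theorem padPerm_newUnder {m : ℕ} (σ : Equiv.Perm (Fin (2 * m))) :
    padPerm σ (newUnder m) = newUnder m :=
  σ.extendDomain_apply_not_subtype (padEquiv m) (by simp)

/-- Padding the identity gives the identity. [folklore] -/
@[simp] theorem padPerm_one {m : ℕ} : padPerm (1 : Equiv.Perm (Fin (2 * m))) = 1 :=
  Equiv.Perm.extendDomain_one _

/-- Padding is multiplicative. [folklore] -/
theorem padPerm_mul {m : ℕ} (σ τ : Equiv.Perm (Fin (2 * m))) :
    padPerm (σ * τ) = padPerm σ * padPerm τ :=
  (Equiv.Perm.extendDomain_mul _ σ τ).symm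

/-- Padding commutes with inversion. [folklore] -/
theorem padPerm_inv {m : ℕ} (σ : Equiv.Perm (Fin (2 * m))) :
    padPerm σ⁻¹ = (padPerm σ)⁻¹ :=
  (Equiv.Perm.extendDomain_inv σ _).symm

/-- The inverse of the identity permutation is the identity (`rfl`; no longer a default `simp`
lemma of Mathlib). [folklore] -/
@[simp] theorem perm_one_symm {α : Type*} : Equiv.symm (1 : Equiv.Perm α) = 1 := rfl

/-- The identity permutation is the identity map. [folklore] -/
@[simp] theorem perm_coe_one {α : Type*} : ⇑(1 : Equiv.Perm α) = id := rfl

/-- The over-passages of a diagram with renumbered marked points only. [folklore] -/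
@[simp] theorem relabel_one_overPos (τ : Equiv.Perm (Fin (2 * L.n))) :
    (L.relabel τ 1).overPos = τ ∘ L.overPos := rfl

/-- The under-passages of a diagram with renumbered marked points only. [folklore] -/
@[simp] theorem relabel_one_underPos (τ : Equiv.Perm (Fin (2 * L.n))) :
    (L.relabel τ 1).underPos = τ ∘ L.underPos := rfl

/-- The signs of a diagram with renumbered marked points only. [folklore] -/
@[simp] theorem relabel_one_sign (τ : Equiv.Perm (Fin (2 * L.n))) :
    (L.relabel τ 1).sign = L.sign := rfl

/-- Two link Gauss diagrams with the same numbers of chords and free circles are equal as soon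
as their chord ends, signs and successors agree. [folklore] -/
theorem mk_eq_mk {n f : ℕ} {o o' u u' : Fin n → Fin (2 * n)} {s s' : Fin n → ℤˣ}
    {b : Bijective (Sum.elim o u)} {b' : Bijective (Sum.elim o' u')}
    {x x' : Equiv.Perm (Fin (2 * n))} (ho : o = o') (hu : u = u') (hs : s = s')
    (hx : x = x') : (⟨n, f, o, u, s, b, x⟩ : LinkGaussDiagram) = ⟨n, f, o', u', s', b', x'⟩ := by
  subst ho hu hs hx; rfl

/-- Injectivity of the chord ends of `insertChord`. [folklore] -/
theorem insertChord_injective_aux :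
    Injective (Sum.elim
      (fun i : Fin (L.n + 1) ↦
        if h : (i : ℕ) < L.n then padPos (L.overPos ⟨i, h⟩) else newOver L.n)
      (fun i : Fin (L.n + 1) ↦
        if h : (i : ℕ) < L.n then padPos (L.underPos ⟨i, h⟩) else newUnder L.n)) := by
  have ho := L.overPos_injective; have hu := L.underPos_injective
  have hou := L.overPos_ne_underPos
  rintro (i | i) (j | j) h <;> simp only [Sum.elim_inl, Sum.elim_inr] at h <;>
    split_ifs at h with h₁ h₂ h₂ <;>
    first
    | simpa [Fin.ext_iff] using ho (padPos_inj.1 h)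
    | simpa [Fin.ext_iff] using hu (padPos_inj.1 h)
    | exact absurd (padPos_inj.1 h) (hou _ _)
    | exact absurd (padPos_inj.1 h).symm (hou _ _)
    | exact absurd h (padPos_ne_newOver _)
    | exact absurd h (padPos_ne_newUnder _)
    | exact absurd h (newOver_ne_padPos _)
    | exact absurd h (newUnder_ne_padPos _)
    | exact absurd h (newOver_ne_newUnder _)
    | exact absurd h (newUnder_ne_newOver _)
    | (simp only [Fin.ext_iff, Sum.inl.injEq, Sum.inr.injEq]; omega)

/-- **Insert one chord** — the link tower's `GaussDiagram.insertChord`: `n + 1` chords, same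
free circles; the old point `q` keeps its number (`padPos q`); the new chord `Fin.last n` has
sign `ε`, over-passage `newOver n = 2n`, under-passage `newUnder n = 2n + 1`, and these are
SPLICED into the traversal, `newOver n` right after `P`, then `newUnder n` right after `Q`:
`next' = padPerm next * swap P (newOver n) * swap Q (newUnder n)` (`P`, `Q` in the NEW
numbering: `Q = newOver n` lands the under-passage behind the over-passage, `Q = P` between `P`
and `newOver n`; `P = newOver n` splices nothing and leaves the over-passage on a one-point
component, cf. `insertKinkFree`). Reducible, so that `simp` computes all fields.
Polyak (2010), §2; GPV (2000), §1, Fig. 3. [cite: Polyak2010, §2] -/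
abbrev insertChord (P Q : Fin (2 * (L.n + 1))) (ε : ℤˣ) : LinkGaussDiagram where
  n := L.n + 1
  free := L.free
  overPos i := if h : (i : ℕ) < L.n then padPos (L.overPos ⟨i, h⟩) else newOver L.n
  underPos i := if h : (i : ℕ) < L.n then padPos (L.underPos ⟨i, h⟩) else newUnder L.n
  sign i := if h : (i : ℕ) < L.n then L.sign ⟨i, h⟩ else ε
  bijective := L.insertChord_injective_aux.bijective_of_nat_card_le (by simp; omega)
  next := padPerm L.next * Equiv.swap P (newOver L.n) * Equiv.swap Q (newUnder L.n)

section InsertChord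

variable (P Q : Fin (2 * (L.n + 1))) (ε : ℤˣ)

/-- The chords of `insertChord`: old chords keep passages (padded) and signs; the new chord
`Fin.last n` is over at `newOver n`, under at `newUnder n`, with sign `ε`. [folklore] -/
theorem insertChord_chords (i : Fin L.n) :
    (L.insertChord P Q ε).overPos i.castSucc = padPos (L.overPos i) ∧
    (L.insertChord P Q ε).underPos i.castSucc = padPos (L.underPos i) ∧
    (L.insertChord P Q ε).sign i.castSucc = L.sign i ∧
    (L.insertChord P Q ε).overPos (Fin.last L.n) = newOver L.n ∧
    (L.insertChord P Q ε).underPos (Fin.last L.n) = newUnder L.n ∧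
    (L.insertChord P Q ε).sign (Fin.last L.n) = ε := by
  simp

/-- **Inserting a chord commutes with renumbering the marked points** (the renumbering
being padded by the identity on the two new points). [folklore] -/
theorem insertChord_relabel (τ : Equiv.Perm (Fin (2 * L.n))) :
    (L.relabel τ 1).insertChord (padPerm τ P) (padPerm τ Q) ε =
      (L.insertChord P Q ε).relabel (padPerm τ) 1 := by
  refine mk_eq_mk (funext fun i ↦ ?_) (funext fun i ↦ ?_) (funext fun i ↦ ?_) ?_ <;>
    try simp only [comp_apply, perm_one_symm, perm_coe_one, id_eq]
  · by_cases h : (i : ℕ) < L.n <;> simp [relabel_n, h]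
  · by_cases h : (i : ℕ) < L.n <;> simp [relabel_n, h]
  · by_cases h : (i : ℕ) < L.n <;> simp [relabel_n, h]
  · show padPerm (τ * L.next * τ⁻¹) * Equiv.swap (padPerm τ P) (newOver L.n) *
        Equiv.swap (padPerm τ Q) (newUnder L.n) = padPerm τ *
        (padPerm L.next * Equiv.swap P (newOver L.n) * Equiv.swap Q (newUnder L.n)) *
          (padPerm τ)⁻¹
    conv_lhs => rw [← padPerm_newOver τ, ← padPerm_newUnder τ]
    rw [Equiv.swap_apply_apply, Equiv.swap_apply_apply, padPerm_mul, padPerm_mul, padPerm_inv]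
    group

/-- Rewriting the base diagram of an insertion (positions carried along `Fin.cast`).
[folklore] -/
theorem insertChord_congr {Z Z' : LinkGaussDiagram} (h : Z = Z') (P Q : Fin (2 * (Z.n + 1)))
    (ε : ℤˣ) : Z.insertChord P Q ε =
      Z'.insertChord (Fin.cast (by rw [h]) P) (Fin.cast (by rw [h]) Q) ε := by
  subst h; rfl

end InsertChord

/-- **`Ω1`: insert a kink** on the arc leaving the marked point `p`: the new chord (`Fin.last n`,
sign `ε`) has its ends consecutive right after `p`, `p → newOver n → newUnder n → next p` if
`overFirst` (kink entered along the over-strand: the knot tower's `PolyakMove.omega1a`,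
positions `p, p + 1` = tail, head), `p → newUnder n → newOver n → next p` otherwise
(`PolyakMove.omega1b`); with both signs these are Polyak's four first moves `Ω1a–Ω1d`.
Polyak (2010), §1, Fig. 1 and §2; GPV (2000), Fig. 3. [cite: Polyak2010, §2] -/
abbrev insertKink (p : Fin (2 * L.n)) (overFirst : Bool) (ε : ℤˣ) : LinkGaussDiagram :=
  L.insertChord (padPos p) (if overFirst then newOver L.n else padPos p) ε

section InsertKink

variable (p : Fin (2 * L.n)) (b : Bool) (ε : ℤˣ)

/-- Off `p` the old successors are kept by a kink. [folklore] -/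
@[simp] theorem insertKink_next_padPos_of_ne {r : Fin (2 * L.n)} (hr : r ≠ p) :
    (L.insertKink p b ε).next (padPos r) = padPos (L.next r) := by
  cases b
  · simp [Equiv.swap_apply_of_ne_of_ne, hr]
  · simp [Equiv.swap_apply_of_ne_of_ne, hr]

/-- **The traversal through the kink**: after `p` the first end, then the second, then
`next p`. [folklore] -/
theorem insertKink_next :
    (L.insertKink p b ε).next (padPos p) = (if b then newOver L.n else newUnder L.n) ∧
    (L.insertKink p b ε).next (newOver L.n) = (if b then newUnder L.n else padPos (L.next p)) ∧
    (L.insertKink p b ε).next (newUnder L.n) = (if b then padPos (L.next p) else newOver L.n) := by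
  cases b
  · simp [Equiv.swap_apply_of_ne_of_ne]
  · simp [Equiv.swap_apply_of_ne_of_ne]

end InsertKink

/-- **`Ω1` on a chord-free circle**: one of the `free` round components becomes the component
`newOver n → newUnder n → newOver n` through the single new chord (`Fin.last n`, sign `ε`);
`free` drops by one (meaningful for `0 < free`). The only first move out of `unknots 1`; its
result there is the image of the knot tower's `GaussDiagram.kink ε` (sanity check below).
Polyak (2010), §1, Fig. 1. [cite: Polyak2010, §2] -/
abbrev insertKinkFree (ε : ℤˣ) : LinkGaussDiagram :=
  { L.insertChord (newOver L.n) (newOver L.n) ε with free := L.free - 1 }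

/-- **`Ω2`: insert a bigon** between the arcs leaving `p` (over-strand) and `q` (under-strand):
two new chords inserted in this order, `x = n` (sign `ε`, over at `2n`, under at `2n + 1`) and
`y = n + 1` (sign `-ε`, over at `2n + 2`, under at `2n + 3`). Over-strand
`p → 2n → 2n + 2 → next p`; under-strand `q → 2n + 1 → 2n + 3 → next q` (under `x`, then
under `y`: CO-ORIENTED) if `parallel` — Polyak's `Ω2a/Ω2b` according to `ε`, the knot tower's
`PolyakMove.omega2a` (`overPos y = overPos x + 1`, `underPos y = underPos x + 1`) — and
`q → 2n + 3 → 2n + 1 → next q` (ANTI-PARALLEL) otherwise — Polyak's `Ω2c/Ω2d`, the knot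
tower's `RMove.omega2c` (`underPos x = underPos y + 1`); see `rMove_omega2`. For `q = p` (an
arc with itself) the under-passages come first; the other order is `insertBigonBehind`.
Polyak (2010), §1, Fig. 2; GPV (2000), Fig. 3. [cite: Polyak2010, §2] -/
abbrev insertBigon (p q : Fin (2 * L.n)) (parallel : Bool) (ε : ℤˣ) : LinkGaussDiagram :=
  (L.insertChord (padPos p) (padPos q) ε).insertChord (padPos (newOver L.n))
    (padPos (if parallel then newUnder L.n else padPos q)) (-ε)

/-- **`Ω2` of an arc with itself, under-passages behind**: the bigon whose four passages are
consecutive on the arc leaving `p` in the order over `x`, over `y`, then under `x`, under `y`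
(`parallel`; Gauss word `x y x y`, never planar) or under `y`, under `x` (anti-parallel: an arc
folded back under itself, `x y y x`). With `insertBigon p p` these are all second moves inside
one arc. Polyak (2010), §1, Fig. 2. [cite: Polyak2010, §2] -/
abbrev insertBigonBehind (p : Fin (2 * L.n)) (parallel : Bool) (ε : ℤˣ) : LinkGaussDiagram :=
  (L.insertChord (padPos p) (newOver L.n) ε).insertChord (padPos (newOver L.n))
    (if parallel then padPos (newUnder L.n) else newOver (L.n + 1)) (-ε)

section InsertBigon

variable (p q : Fin (2 * L.n)) (par : Bool) (ε : ℤˣ)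

/-- The chords of the bigon: old chords padded twice; `x = n` over at `2n`, under at `2n + 1`,
sign `ε`; `y = n + 1` over at `2n + 2`, under at `2n + 3`, sign `-ε`. [folklore] -/
theorem insertBigon_chords (i : Fin L.n) :
    (L.insertBigon p q par ε).overPos i.castSucc.castSucc = padPos (padPos (L.overPos i)) ∧
    (L.insertBigon p q par ε).underPos i.castSucc.castSucc = padPos (padPos (L.underPos i)) ∧
    (L.insertBigon p q par ε).overPos (Fin.last L.n).castSucc = padPos (newOver L.n) ∧
    (L.insertBigon p q par ε).underPos (Fin.last L.n).castSucc = padPos (newUnder L.n) ∧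
    (L.insertBigon p q par ε).sign (Fin.last L.n).castSucc = ε ∧
    (L.insertBigon p q par ε).overPos (Fin.last (L.n + 1)) = newOver (L.n + 1) ∧
    (L.insertBigon p q par ε).underPos (Fin.last (L.n + 1)) = newUnder (L.n + 1) ∧
    (L.insertBigon p q par ε).sign (Fin.last (L.n + 1)) = -ε := by
  simp

/-- **The over-strand of the bigon**: `p → 2n → 2n + 2 → next p` (`q ≠ p`). [folklore] -/
theorem insertBigon_next_over (hpq : q ≠ p) :
    (L.insertBigon p q par ε).next (padPos (padPos p)) = padPos (newOver L.n) ∧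
    (L.insertBigon p q par ε).next (padPos (newOver L.n)) = newOver (L.n + 1) ∧
    (L.insertBigon p q par ε).next (newOver (L.n + 1)) = padPos (padPos (L.next p)) := by
  cases par
  · simp [Equiv.swap_apply_of_ne_of_ne, hpq.symm]
  · simp [Equiv.swap_apply_of_ne_of_ne, hpq.symm]

/-- **The under-strand of the co-oriented bigon**: `q → 2n + 1 → 2n + 3 → next q` (`q ≠ p`).
[folklore] -/
theorem insertBigon_next_under_parallel (hpq : q ≠ p) :
    (L.insertBigon p q true ε).next (padPos (padPos q)) = padPos (newUnder L.n) ∧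
    (L.insertBigon p q true ε).next (padPos (newUnder L.n)) = newUnder (L.n + 1) ∧
    (L.insertBigon p q true ε).next (newUnder (L.n + 1)) = padPos (padPos (L.next q)) := by
  simp [Equiv.swap_apply_of_ne_of_ne, hpq]

/-- **The under-strand of the anti-parallel bigon**: `q → 2n + 3 → 2n + 1 → next q`
(`q ≠ p`). [folklore] -/
theorem insertBigon_next_under_anti (hpq : q ≠ p) :
    (L.insertBigon p q false ε).next (padPos (padPos q)) = newUnder (L.n + 1) ∧
    (L.insertBigon p q false ε).next (newUnder (L.n + 1)) = padPos (newUnder L.n) ∧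
    (L.insertBigon p q false ε).next (padPos (newUnder L.n)) = padPos (padPos (L.next q)) := by
  simp [Equiv.swap_apply_of_ne_of_ne, hpq]

end InsertBigon

/-- Move the chord ends by a permutation `τ` of the marked points, keeping chords, signs, and the
traversal (`GaussDiagram.mapPos`; unlike `relabel τ 1`, `next` is NOT conjugated). [folklore] -/
def mapPos (τ : Equiv.Perm (Fin (2 * L.n))) : LinkGaussDiagram where
  n := L.n
  free := L.free
  overPos := τ ∘ L.overPos
  underPos := τ ∘ L.underPos
  sign := L.sign
  bijective := by rw [← Sum.comp_elim]; exact τ.bijective.comp L.bijective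
  next := L.next

/-- **The braid rearrangement** of three chords `x y z` (`GaussDiagram.braidMove` verbatim): the
transpositions `overPos x ↔ overPos y`, `underPos x ↔ overPos z`, `underPos y ↔ underPos z`
of marked points applied to all chord ends, the traversal being kept. Under the triangle
hypotheses of `RMove.triangle` (top strand `next (overPos x) = overPos y`, middle strand
`next (underPos x) = overPos z`, bottom strand `next (underPos y) = underPos z`, signs `+1`) it
reverses the order of the two passages on each strand: the positive braid-like third move
`σ₁σ₂σ₁ → σ₂σ₁σ₂`, Polyak's `Ω3b` (the knot tower's `PolyakMove.omega3a`, sic).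
Polyak (2010), §1, footnote 2; GPV (2000), Fig. 3. [cite: Polyak2010, §1] -/
abbrev braidMove (x y z : Fin L.n) : LinkGaussDiagram :=
  L.mapPos (Equiv.swap (L.overPos x) (L.overPos y) * Equiv.swap (L.underPos x) (L.overPos z) *
    Equiv.swap (L.underPos y) (L.underPos z))

/-- **The knot tower's braid rearrangement is the link tower's** (definitionally). [folklore] -/
theorem ofGaussDiagram_braidMove (G : GaussDiagram) (x y z : Fin G.n) :
    ofGaussDiagram (G.braidMove x y z) = (ofGaussDiagram G).braidMove x y z := rfl

/-! ## Reidemeister moves and Reidemeister equivalence of link Gauss diagrams -/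

/-- **Reidemeister moves on link Gauss diagrams** (creating direction only; `REquiv` supplies
the inverses), the link tower's `GaussDiagram.RMove` (= `PolyakMove` + `omega2c`) with
"`q + 1`" replaced by "`next q`" — conventions in the module docstring: `relabel`
(`IsRelabelling`), `kink` (`Ω1a–d`), `kinkFree` (`Ω1` on a chord-free circle, `0 < free`),
`bigon` (`Ω2a/b` if `parallel`, else `Ω2c/d`), `bigonBehind` (`Ω2` inside one arc), `triangle`
(`Ω3b`, on a triangle `next (overPos x) = overPos y`, `next (underPos x) = overPos z`,
`next (underPos y) = underPos z`, signs `+1`). It contains Polyak's generating set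
`{Ω1a, Ω1b, Ω2c, Ω2d, Ω3b}` of oriented moves, applied regardless of planarity (virtual moves,
GPV (2000), §1.5). Polyak (2010), Thm. 1.2; GPV (2000), Fig. 3. [cite: Polyak2010, Thm 1.2] -/
inductive RMove : LinkGaussDiagram → LinkGaussDiagram → Prop
  /-- Bookkeeping: renumber marked points and chords. -/
  | relabel {L L' : LinkGaussDiagram} (h : L.IsRelabelling L') : RMove L L'
  /-- `Ω1a–d`: a kink on the arc leaving `p`, over-passage first iff `overFirst`, sign `ε`. -/
  | kink (L : LinkGaussDiagram) (p : Fin (2 * L.n)) (overFirst : Bool) (ε : ℤˣ) :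
      RMove L (L.insertKink p overFirst ε)
  /-- `Ω1` on a chord-free circle. -/
  | kinkFree (L : LinkGaussDiagram) (h : 0 < L.free) (ε : ℤˣ) : RMove L (L.insertKinkFree ε)
  /-- `Ω2a/b` (`parallel`) or `Ω2c/d`: a bigon, over-strand after `p`, under-strand after `q`. -/
  | bigon (L : LinkGaussDiagram) (p q : Fin (2 * L.n)) (parallel : Bool) (ε : ℤˣ) :
      RMove L (L.insertBigon p q parallel ε)
  /-- `Ω2` inside the arc leaving `p`, under-passages behind the over-passages. -/
  | bigonBehind (L : LinkGaussDiagram) (p : Fin (2 * L.n)) (parallel : Bool) (ε : ℤˣ) :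
      RMove L (L.insertBigonBehind p parallel ε)
  /-- `Ω3b`: the positive braid-like third move on a triangle `x y z`. -/
  | triangle (L : LinkGaussDiagram) (x y z : Fin L.n) (hx : L.sign x = 1) (hy : L.sign y = 1)
      (hz : L.sign z = 1) (ha : L.next (L.overPos x) = L.overPos y)
      (hb : L.next (L.underPos x) = L.overPos z) (hc : L.next (L.underPos y) = L.underPos z) :
      RMove L (L.braidMove x y z)

/-- **Reidemeister equivalence** of link Gauss diagrams: the equivalence relation generated by
`RMove` (`Relation.EqvGen`, exactly as `GaussDiagram.REquiv`). [cite: Polyak2010, Thm 1.2] -/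
protected def REquiv : LinkGaussDiagram → LinkGaussDiagram → Prop :=
  Relation.EqvGen RMove

/-- `REquiv` is an equivalence relation. [folklore] -/
theorem equivalence_rEquiv : Equivalence LinkGaussDiagram.REquiv :=
  Relation.EqvGen.is_equivalence _

variable {L}

/-- `REquiv` is transitive. [folklore] -/
protected theorem REquiv.trans {L' L'' : LinkGaussDiagram} (h : L.REquiv L')
    (h' : L'.REquiv L'') : L.REquiv L'' :=
  Relation.EqvGen.trans _ _ _ h h'

/-- A move is an equivalence. [folklore] -/
theorem RMove.rEquiv {L' : LinkGaussDiagram} (h : RMove L L') : L.REquiv L' :=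
  Relation.EqvGen.rel _ _ h

/-- Relabellings are Reidemeister equivalent. [folklore] -/
theorem IsRelabelling.rEquiv {L' : LinkGaussDiagram} (h : L.IsRelabelling L') : L.REquiv L' :=
  (RMove.relabel h).rEquiv

/-- A relabelled diagram is Reidemeister equivalent to the original. [folklore] -/
theorem rEquiv_relabel (L : LinkGaussDiagram) (τ : Equiv.Perm (Fin (2 * L.n)))
    (κ : Equiv.Perm (Fin L.n)) : L.REquiv (L.relabel τ κ) :=
  IsRelabelling.rEquiv ⟨τ, κ, rfl⟩

/-- The colouring of a kinked diagram: old points keep their colour; the end of the new chord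
met first gets `!c p`, the second one `c p`. [cite: Rasmussen2010, §2.3] -/
def kinkColour (c : Fin (2 * L.n) → Bool) (p : Fin (2 * L.n)) (b : Bool)
    (x : Fin (2 * (L.n + 1))) : Bool :=
  if h : (x : ℕ) < 2 * L.n then c ⟨x, h⟩
  else if ((x : ℕ) = 2 * L.n) = (b = true) then !c p else c p

/-- **Checkerboard colourings extend across `Ω1`**, so kinks stay inside the `d² = 0` regime
of `LinkKhDSquared`. Rasmussen (2010), Lemma 2.4. [cite: Rasmussen2010, §2.3] -/
theorem IsCheckerboard.insertKink {c : Fin (2 * L.n) → Bool} (hc : L.IsCheckerboard c)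
    (p : Fin (2 * L.n)) (b : Bool) (ε : ℤˣ) :
    (L.insertKink p b ε).IsCheckerboard (L.kinkColour c p b) := by
  have vpad : ∀ r : Fin (2 * L.n), L.kinkColour c p b (padPos r) = c r := fun r ↦ by
    simp [kinkColour]
  have vO : L.kinkColour c p b (newOver L.n) = if b then !c p else c p := by
    cases b <;> simp [kinkColour]
  have vU : L.kinkColour c p b (newUnder L.n) = if b then c p else !c p := by
    cases b <;> simp [kinkColour]
  refine ⟨fun y ↦ ?_, fun i ↦ ?_⟩
  · rcases cases_pos y with ⟨r, rfl⟩ | rfl | rfl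
    · by_cases hr : r = p
      · subst hr
        cases b <;> simp [Equiv.swap_apply_of_ne_of_ne, vpad, vO, vU]
      · cases b <;> simp [Equiv.swap_apply_of_ne_of_ne, hr, vpad, hc.apply_next]
    · cases b <;> simp [Equiv.swap_apply_of_ne_of_ne, vpad, vO, vU, hc.apply_next]
    · cases b <;> simp [vpad, vO, vU, hc.apply_next]
  · rcases Fin.eq_castSucc_or_eq_last i with ⟨j, rfl⟩ | rfl
    · simp [vpad, hc.apply_underPos]
    · cases b <;> simp [vO, vU]

/-! ## The knot tower inside the link tower -/

open Literature.Analysis.TotalPositivity (val_succAbove)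

/-- The value of the rotation `finRotate`. [folklore] -/
theorem coe_finRotate_eq_ite {m : ℕ} (x : Fin m) :
    ((finRotate m x : Fin m) : ℕ) = if (x : ℕ) + 1 = m then 0 else (x : ℕ) + 1 := by
  rcases m with - | m
  · exact x.elim0
  rw [coe_finRotate]
  by_cases hx : x = Fin.last m
  · subst hx; simp
  · rw [if_neg hx, if_neg fun h ↦ hx (Fin.ext (by rw [Fin.val_last]; omega))]

/-- An adjacency `b = a + 1` of positions is a step of the rotation. [folklore] -/
theorem finRotate_eq_of_val_eq {m : ℕ} {a b : Fin m} (h : (b : ℕ) = a + 1) :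
    finRotate m a = b :=
  Fin.ext (by rw [coe_finRotate_eq_ite, h]; have := b.isLt; rw [if_neg (by omega)])

section Knot

variable (G : GaussDiagram) (o : Fin (2 * G.n + 2)) (u : Fin (2 * G.n + 1))

/-- **The dictionary of marked points** between the link tower's insertion (old point `q` keeps
its number, new chord at `2n`, `2n + 1`) and the knot tower's `G.insertChord o u ε` (new chord
at `o`, `o.succAbove u`, old point `q` at `o.succAbove (u.succAbove q)`):
`padPos q ↦ o.succAbove (u.succAbove q)`, `newOver n ↦ o`, `newUnder n ↦ o.succAbove u`.
[folklore] -/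
def knotPos (x : Fin (2 * (G.n + 1))) : Fin (2 * G.n + 2) :=
  if h : (x : ℕ) < 2 * G.n then o.succAbove (u.succAbove ⟨x, h⟩)
  else if (x : ℕ) = 2 * G.n then o else o.succAbove u

/-- The dictionary on old points. [folklore] -/
@[simp] theorem knotPos_padPos (q : Fin (2 * G.n)) :
    knotPos G o u (padPos q) = o.succAbove (u.succAbove q) := by
  have hq : ((padPos q : Fin (2 * (G.n + 1))) : ℕ) < 2 * G.n := q.isLt
  unfold knotPos
  rw [dif_pos hq]
  rfl

/-- The dictionary on the new over-passage. [folklore] -/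
@[simp] theorem knotPos_newOver : knotPos G o u (newOver G.n) = o := by
  have h1 : ¬ ((newOver G.n : Fin _) : ℕ) < 2 * G.n := by simp
  have h2 : ((newOver G.n : Fin _) : ℕ) = 2 * G.n := by simp
  unfold knotPos
  rw [dif_neg h1, if_pos h2]

/-- The dictionary on the new under-passage. [folklore] -/
@[simp] theorem knotPos_newUnder : knotPos G o u (newUnder G.n) = o.succAbove u := by
  have h1 : ¬ ((newUnder G.n : Fin _) : ℕ) < 2 * G.n := by simp
  have h2 : ((newUnder G.n : Fin _) : ℕ) ≠ 2 * G.n := by simp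
  unfold knotPos
  rw [dif_neg h1, if_neg h2]

/-- The dictionary is injective. [folklore] -/
theorem knotPos_injective : Injective (knotPos G o u) := by
  intro x y h
  rcases cases_pos x with ⟨x, rfl⟩ | rfl | rfl <;>
    rcases cases_pos y with ⟨y, rfl⟩ | rfl | rfl <;>
    simp only [knotPos_padPos, knotPos_newOver, knotPos_newUnder, Fin.succAbove_right_inj] at h <;>
    first
    | rfl
    | rw [h]
    | exact absurd h (Fin.succAbove_ne _ _)
    | exact absurd h.symm (Fin.succAbove_ne _ _)

/-- The dictionary as a permutation of the marked points of the enlarged diagram. [folklore] -/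
def knotPerm : Equiv.Perm (Fin (2 * (G.n + 1))) :=
  Equiv.ofBijective (knotPos G o u) ((Fintype.bijective_iff_injective_and_card _).2
    ⟨knotPos_injective G o u, by simp⟩)

/-- The permutation is the dictionary. [folklore] -/
@[simp] theorem knotPerm_apply (x : Fin (2 * (G.n + 1))) :
    knotPerm G o u x = knotPos G o u x := rfl

/-- **One chord insertion of the knot tower is one chord insertion of the link tower, up to the
dictionary**, as soon as the traversals match: if transporting the spliced successor of
`(ofGaussDiagram G).insertChord P Q ε` along `knotPos` gives `+ 1 (mod 2n + 2)`, the image of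
`G.insertChord o u ε` is the relabelling by `knotPerm` of that link insertion (the chord data
always match). [cite: Polyak2010, §2] -/
theorem ofGaussDiagram_insertChord (ε : ℤˣ) (P Q : Fin (2 * (G.n + 1)))
    (hnext : ∀ x : Fin (2 * (G.n + 1)),
      (knotPos G o u (((ofGaussDiagram G).insertChord P Q ε).next x) : ℕ) =
        if (knotPos G o u x : ℕ) + 1 = 2 * G.n + 2 then 0 else (knotPos G o u x : ℕ) + 1) :
    ofGaussDiagram (G.insertChord o u ε) =
      ((ofGaussDiagram G).insertChord P Q ε).relabel (knotPerm G o u) 1 := by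
  refine mk_eq_mk (funext fun i ↦ ?_) (funext fun i ↦ ?_) (funext fun i ↦ ?_) ?_ <;>
    (try simp only [comp_apply, perm_one_symm, perm_coe_one, id_eq]) <;> delta ofGaussDiagram
  · rcases Fin.eq_castSucc_or_eq_last i with ⟨j, rfl⟩ | rfl <;> simp
  · rcases Fin.eq_castSucc_or_eq_last i with ⟨j, rfl⟩ | rfl <;> simp
  · rcases Fin.eq_castSucc_or_eq_last i with ⟨j, rfl⟩ | rfl <;> simp
  · show finRotate _ = knotPerm G o u *
      (padPerm (finRotate (2 * G.n)) * Equiv.swap P (newOver G.n) * Equiv.swap Q (newUnder G.n)) *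
        (knotPerm G o u)⁻¹
    rw [eq_mul_inv_iff_mul_eq]
    refine Equiv.ext fun x ↦ Fin.ext ?_
    change ((finRotate (2 * (G.n + 1)) (knotPos G o u x) : Fin _) : ℕ) = _
    rw [coe_finRotate_eq_ite]
    refine Eq.trans ?_ (hnext x).symm
    split_ifs <;> omega

/-- **`Ω1a` is `insertKink _ true`**: the knot tower's `G.insertChord p.castSucc p ε` (new chord
at the adjacent positions `p`, `p + 1`, tail first) is the link tower's kink after the old
point `r` preceding `p` (`p = r + 1`, or `p = 0` and `r = 2n - 1` across the base point), up to
`knotPerm`. [cite: Polyak2010, §2] -/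
theorem ofGaussDiagram_omega1a (p : Fin (2 * G.n + 1)) (r : Fin (2 * G.n))
    (hpr : (p : ℕ) = r + 1 ∨ ((p : ℕ) = 0 ∧ (r : ℕ) + 1 = 2 * G.n)) (ε : ℤˣ) :
    ofGaussDiagram (G.insertChord p.castSucc p ε) =
      ((ofGaussDiagram G).insertKink r true ε).relabel (knotPerm G p.castSucc p) 1 := by
  refine ofGaussDiagram_insertChord G _ _ ε _ _ fun x ↦ ?_
  delta ofGaussDiagram
  have hr := r.isLt; have hp := p.isLt
  rcases cases_pos x with ⟨q, rfl⟩ | rfl | rfl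
  · have hql := q.isLt
    by_cases hq : q = r
    · subst hq
      simp [Equiv.swap_apply_of_ne_of_ne, val_succAbove]
      split_ifs <;> omega
    · have hq' : (q : ℕ) ≠ r := fun h ↦ hq (Fin.ext h)
      simp [Equiv.swap_apply_of_ne_of_ne, hq, val_succAbove, coe_finRotate_eq_ite,
        -finRotate_apply]
      split_ifs <;> omega
  · simp [Equiv.swap_apply_of_ne_of_ne]
    omega
  · simp [val_succAbove, coe_finRotate_eq_ite, -finRotate_apply]
    split_ifs <;> omega

/-- **`Ω1b` is `insertKink _ false`**: the knot tower's `G.insertChord p.succ p ε` (under at `p`,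
over at `p + 1`) is the link tower's kink after the old point `r` preceding `p`, under-passage
first, up to `knotPerm`. [cite: Polyak2010, §2] -/
theorem ofGaussDiagram_omega1b (p : Fin (2 * G.n + 1)) (r : Fin (2 * G.n))
    (hpr : (p : ℕ) = r + 1 ∨ ((p : ℕ) = 0 ∧ (r : ℕ) + 1 = 2 * G.n)) (ε : ℤˣ) :
    ofGaussDiagram (G.insertChord p.succ p ε) =
      ((ofGaussDiagram G).insertKink r false ε).relabel (knotPerm G p.succ p) 1 := by
  refine ofGaussDiagram_insertChord G _ _ ε _ _ fun x ↦ ?_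
  delta ofGaussDiagram
  have hr := r.isLt; have hp := p.isLt
  rcases cases_pos x with ⟨q, rfl⟩ | rfl | rfl
  · have hql := q.isLt
    by_cases hq : q = r
    · subst hq
      simp [Equiv.swap_apply_of_ne_of_ne, val_succAbove]
      split_ifs <;> omega
    · have hq' : (q : ℕ) ≠ r := fun h ↦ hq (Fin.ext h)
      simp [Equiv.swap_apply_of_ne_of_ne, hq, val_succAbove, coe_finRotate_eq_ite,
        -finRotate_apply]
      split_ifs <;> omega
  · simp [Equiv.swap_apply_of_ne_of_ne, val_succAbove, coe_finRotate_eq_ite,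
      -finRotate_apply]
    split_ifs <;> omega
  · simp
    omega

/-- The old point preceding the knot position `p : Fin (2n + 1)` (cyclically; needs `n ≠ 0`).
[folklore] -/
theorem exists_pred_pos (hn : G.n ≠ 0) (p : Fin (2 * G.n + 1)) :
    ∃ r : Fin (2 * G.n), (p : ℕ) = r + 1 ∨ ((p : ℕ) = 0 ∧ (r : ℕ) + 1 = 2 * G.n) := by
  by_cases hp : (p : ℕ) = 0
  · exact ⟨⟨2 * G.n - 1, by omega⟩, .inr ⟨hp, by simp; omega⟩⟩
  · exact ⟨⟨p - 1, by omega⟩, .inl (by simp; omega)⟩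

/-- **Every instance of the knot tower's `Ω1a` is a link move** up to relabelling, for a
non-empty knot diagram (for `G.n = 0` the image `unknots 0` has no arc; see the module
docstring). [cite: Polyak2010, §2] -/
theorem rEquiv_ofGaussDiagram_omega1a (hn : G.n ≠ 0) (p : Fin (2 * G.n + 1)) (ε : ℤˣ) :
    (ofGaussDiagram G).REquiv (ofGaussDiagram (G.insertChord p.castSucc p ε)) := by
  obtain ⟨r, hr⟩ := exists_pred_pos G hn p
  have h₁ := (RMove.kink (ofGaussDiagram G) r true ε).rEquiv
  have h₂ := rEquiv_relabel ((ofGaussDiagram G).insertKink r true ε) (knotPerm G p.castSucc p) 1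
  rw [← ofGaussDiagram_omega1a G p r hr ε] at h₂
  exact h₁.trans h₂

/-- **Every instance of the knot tower's `Ω1b` is a link move** (up to relabelling), for
`G.n ≠ 0`. [cite: Polyak2010, §2] -/
theorem rEquiv_ofGaussDiagram_omega1b (hn : G.n ≠ 0) (p : Fin (2 * G.n + 1)) (ε : ℤˣ) :
    (ofGaussDiagram G).REquiv (ofGaussDiagram (G.insertChord p.succ p ε)) := by
  obtain ⟨r, hr⟩ := exists_pred_pos G hn p
  have h₁ := (RMove.kink (ofGaussDiagram G) r false ε).rEquiv
  have h₂ := rEquiv_relabel ((ofGaussDiagram G).insertKink r false ε) (knotPerm G p.succ p) 1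
  rw [← ofGaussDiagram_omega1b G p r hr ε] at h₂
  exact h₁.trans h₂

/-- **Every instance of the knot tower's `Ω3b` (`PolyakMove.omega3a`) is the link move
`RMove.triangle`** on the image (adjacency `q + 1` is a step of `finRotate`).
[cite: Polyak2010, §1] -/
theorem rMove_ofGaussDiagram_omega3a {x y z : Fin G.n} (hx : G.sign x = 1) (hy : G.sign y = 1)
    (hz : G.sign z = 1) (ha : (G.overPos y : ℕ) = G.overPos x + 1)
    (hb : (G.overPos z : ℕ) = G.underPos x + 1) (hc : (G.underPos z : ℕ) = G.underPos y + 1) :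
    RMove (ofGaussDiagram G) (ofGaussDiagram (G.braidMove x y z)) := by
  have ha' : finRotate (2 * G.n) (G.overPos x) = G.overPos y := finRotate_eq_of_val_eq ha
  have hb' : finRotate (2 * G.n) (G.underPos x) = G.overPos z := finRotate_eq_of_val_eq hb
  have hc' : finRotate (2 * G.n) (G.underPos y) = G.underPos z := finRotate_eq_of_val_eq hc
  rw [ofGaussDiagram_braidMove]
  exact RMove.triangle (ofGaussDiagram G) x y z hx hy hz ha' hb' hc'

/-- **The knot tower's bookkeeping move is the link tower's.** [folklore] -/
theorem rMove_ofGaussDiagram_relabel {G G' : GaussDiagram} (h : G.IsRelabelling G') :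
    RMove (ofGaussDiagram G) (ofGaussDiagram G') :=
  RMove.relabel (isRelabelling_ofGaussDiagram h)

/-- **A new chord between two different arcs**: the knot tower's `G.insertChord o u ε` whose
over-passage lands right after the old point `s` and whose under-passage lands right after the
old point `t ≠ s` (`u = t + 1`, `o = s + 1 + [t < s]` in the new numbering) is the link tower's
`insertChord (padPos s) (padPos t) ε` up to `knotPerm`. [cite: Polyak2010, §2] -/
theorem ofGaussDiagram_insertChord_of_ne {s t : Fin (2 * G.n)} (hst : s ≠ t)
    (ho : (o : ℕ) = s + 1 + if (t : ℕ) < s then 1 else 0) (hu : (u : ℕ) = t + 1)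
    (ε : ℤˣ) : ofGaussDiagram (G.insertChord o u ε) =
      ((ofGaussDiagram G).insertChord (padPos s) (padPos t) ε).relabel (knotPerm G o u) 1 := by
  refine ofGaussDiagram_insertChord G _ _ ε _ _ fun x ↦ ?_
  delta ofGaussDiagram
  have hs := s.isLt; have ht := t.isLt; have hst' : (s : ℕ) ≠ t := fun h ↦ hst (Fin.ext h)
  rcases cases_pos x with ⟨q, rfl⟩ | rfl | rfl
  · have hql := q.isLt
    by_cases hqs : q = s
    · subst hqs
      simp [Equiv.swap_apply_of_ne_of_ne, hst, val_succAbove]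
      split_ifs at ho ⊢ <;> omega
    by_cases hqt : q = t
    · subst hqt
      simp [Equiv.swap_apply_of_ne_of_ne, val_succAbove]
      split_ifs at ho ⊢ <;> omega
    have hqs' : (q : ℕ) ≠ s := fun h ↦ hqs (Fin.ext h)
    have hqt' : (q : ℕ) ≠ t := fun h ↦ hqt (Fin.ext h)
    simp [Equiv.swap_apply_of_ne_of_ne, hqs, hqt, val_succAbove, coe_finRotate_eq_ite,
      -finRotate_apply]
    split_ifs at ho ⊢ <;> omega
  · simp [Equiv.swap_apply_of_ne_of_ne, val_succAbove, coe_finRotate_eq_ite,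
      -finRotate_apply]
    split_ifs at ho ⊢ <;> omega
  · simp [Equiv.swap_apply_of_ne_of_ne, hst.symm, val_succAbove, coe_finRotate_eq_ite,
      -finRotate_apply]
    split_ifs at ho ⊢ <;> omega

variable (p q : Fin (2 * G.n)) (par : Bool)

/-- Over-passage of the first chord of the knot tower's bigon matching `insertBigon p q`:
right after the old point `p`. [folklore] -/
def omega2O : Fin (2 * G.n + 2) :=
  ⟨p + 1 + if (q : ℕ) < p then 1 else 0, by split_ifs <;> omega⟩

/-- Under-passage parameter of the first chord: right after the old point `q`. [folklore] -/
def omega2U : Fin (2 * G.n + 1) := ⟨q + 1, by omega⟩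

/-- The point after which the second under-passage lands, in the intermediate knot numbering:
the first under-passage (`parallel`) or the old point `q` (anti-parallel). [folklore] -/
def omega2T : Fin (2 * G.n + 2) :=
  knotPos G (omega2O G p q) (omega2U G q) (if par then newUnder G.n else padPos q)

/-- Over-passage of the second chord: right after that of the first. [folklore] -/
def omega2O' : Fin (2 * (G.n + 1) + 2) :=
  ⟨omega2O G p q + 1 + if (omega2T G p q par : ℕ) < omega2O G p q then 1 else 0,
    by have := (omega2O G p q).isLt; split_ifs <;> omega⟩

/-- Under-passage parameter of the second chord. [folklore] -/
def omega2U' : Fin (2 * (G.n + 1) + 1) :=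
  ⟨omega2T G p q par + 1, by have := (omega2T G p q par).isLt; omega⟩

/-- The second landing point is not the first over-passage. [folklore] -/
theorem omega2O_ne_omega2T : (omega2O G p q : Fin _) ≠ omega2T G p q par := by
  cases par <;> simp [omega2T, Fin.ne_succAbove]

/-- **The link bigon on a knot diagram is a double insertion of the knot tower** up to
relabelling: for arcs `p ≠ q` of `ofGaussDiagram G`, `insertBigon p q par ε` is a relabelling
of the image of `(G.insertChord o u ε).insertChord o' u' (-ε)` for the explicit positions
`omega2O/U/O'/U'` (twice `ofGaussDiagram_insertChord_of_ne`, once `insertChord_relabel`).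
[cite: Polyak2010, §2] -/
theorem isRelabelling_insertBigon_ofGaussDiagram (hpq : p ≠ q) (ε : ℤˣ) :
    ((ofGaussDiagram G).insertBigon p q par ε).IsRelabelling (ofGaussDiagram
      ((G.insertChord (omega2O G p q) (omega2U G q) ε).insertChord (omega2O' G p q par)
        (omega2U' G p q par) (-ε))) := by
  have e₁ := ofGaussDiagram_insertChord_of_ne G (omega2O G p q) (omega2U G q) hpq rfl rfl ε
  have e₂ := ofGaussDiagram_insertChord_of_ne (G.insertChord (omega2O G p q) (omega2U G q) ε)
    (omega2O' G p q par) (omega2U' G p q par) (s := omega2O G p q) (t := omega2T G p q par)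
    (omega2O_ne_omega2T G p q par) rfl rfl (-ε)
  have r₂ : IsRelabelling _ _ := ⟨_, _, e₂⟩
  have e₃ : (ofGaussDiagram (G.insertChord (omega2O G p q) (omega2U G q) ε)).insertChord
      (padPos (omega2O G p q)) (padPos (omega2T G p q par)) (-ε) =
      ((((ofGaussDiagram G).insertChord (padPos p) (padPos q) ε)).relabel
        (knotPerm G (omega2O G p q) (omega2U G q)) 1).insertChord
        (padPerm (knotPerm G (omega2O G p q) (omega2U G q)) (padPos (newOver G.n)))
        (padPerm (knotPerm G (omega2O G p q) (omega2U G q))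
          (padPos (if par then newUnder G.n else padPos q))) (-ε) := by
    rw [insertChord_congr e₁]
    congr 1 <;> refine Fin.ext ?_ <;> simp [omega2T]
  have e₄ := insertChord_relabel ((ofGaussDiagram G).insertChord (padPos p) (padPos q) ε)
    (padPos (newOver G.n)) (padPos (if par then newUnder G.n else padPos q)) (-ε)
    (knotPerm G (omega2O G p q) (omega2U G q))
  rw [e₃.trans e₄] at r₂
  exact IsRelabelling.trans ⟨_, _, rfl⟩ r₂

/-- **… and that double insertion is the knot tower's `Ω2a/b` (parallel) or `Ω2c/d`
(anti-parallel)**: the over-passages of the two new chords are adjacent, tail of `x` first,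
and the under-passages are adjacent in the same (`PolyakMove.omega2a`) resp. opposite
(`RMove.omega2c`) order — the conventions of `insertBigon` are the knot tower's.
[cite: Polyak2010, §1] -/
theorem rMove_omega2 (hpq : p ≠ q) (ε : ℤˣ) :
    GaussDiagram.RMove G ((G.insertChord (omega2O G p q) (omega2U G q) ε).insertChord
      (omega2O' G p q par) (omega2U' G p q par) (-ε)) := by
  have hO : ((omega2O G p q : Fin _) : ℕ) = p + 1 + if (q : ℕ) < p then 1 else 0 := rfl
  have hO' : ((omega2O' G p q par : Fin _) : ℕ) =
      omega2O G p q + 1 + if (omega2T G p q par : ℕ) < omega2O G p q then 1 else 0 := rfl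
  have hU' : ((omega2U' G p q par : Fin _) : ℕ) = omega2T G p q par + 1 := rfl
  have hne : ((omega2O G p q : Fin _) : ℕ) ≠ omega2T G p q par := fun h ↦
    omega2O_ne_omega2T G p q par (Fin.ext h)
  have hp := p.isLt; have hq := q.isLt; have hTl := (omega2T G p q par).isLt
  have hpq' : (p : ℕ) ≠ q := fun h ↦ hpq (Fin.ext h)
  have e1 : ((G.insertChord (omega2O G p q) (omega2U G q) ε).insertChord (omega2O' G p q par)
      (omega2U' G p q par) (-ε)).overPos (Fin.last (G.n + 1)) = omega2O' G p q par :=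
    GaussDiagram.insertChord_overPos_last _ _ _ _
  have e2 : ((G.insertChord (omega2O G p q) (omega2U G q) ε).insertChord (omega2O' G p q par)
      (omega2U' G p q par) (-ε)).overPos (Fin.last G.n).castSucc =
      (omega2O' G p q par).succAbove ((omega2U' G p q par).succAbove (omega2O G p q)) :=
    (GaussDiagram.insertChord_overPos_castSucc _ _ _ _ _).trans
      (by rw [GaussDiagram.insertChord_overPos_last]; rfl)
  have e3 : ((G.insertChord (omega2O G p q) (omega2U G q) ε).insertChord (omega2O' G p q par)
      (omega2U' G p q par) (-ε)).underPos (Fin.last (G.n + 1)) =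
      (omega2O' G p q par).succAbove (omega2U' G p q par) :=
    GaussDiagram.insertChord_underPos_last _ _ _ _
  have e4 : ((G.insertChord (omega2O G p q) (omega2U G q) ε).insertChord (omega2O' G p q par)
      (omega2U' G p q par) (-ε)).underPos (Fin.last G.n).castSucc =
      (omega2O' G p q par).succAbove ((omega2U' G p q par).succAbove
        ((omega2O G p q).succAbove (omega2U G q))) :=
    (GaussDiagram.insertChord_underPos_castSucc _ _ _ _ _).trans
      (by rw [GaussDiagram.insertChord_underPos_last]; rfl)
  have hT : ((omega2T G p q par : Fin _) : ℕ) = if par then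
      (((omega2O G p q).succAbove (omega2U G q) : Fin _) : ℕ) else
      (((omega2O G p q).succAbove ((omega2U G q).succAbove q) : Fin _) : ℕ) := by
    cases par <;> simp [omega2T]
  simp only [val_succAbove, omega2U, hO] at hT
  cases par
  · refine GaussDiagram.RMove.omega2c G _ _ _ _ ε ?_ ?_
    · rw [e1, e2, val_succAbove, val_succAbove, hO', hU']
      split_ifs <;> omega
    · rw [e3, e4, val_succAbove, val_succAbove, val_succAbove,
        val_succAbove, hO', hU']
      simp only [omega2U, hO, Bool.false_eq_true, if_false] at hT ⊢
      split_ifs at hT ⊢ <;> omega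
  · refine GaussDiagram.RMove.polyak (GaussDiagram.PolyakMove.omega2a G _ _ _ _ ε ?_ ?_)
    · rw [e1, e2, val_succAbove, val_succAbove, hO', hU']
      split_ifs <;> omega
    · rw [e3, e4, val_succAbove, val_succAbove, val_succAbove,
        val_succAbove, hO', hU']
      simp only [omega2U, hO, if_true] at hT ⊢
      split_ifs at hT ⊢ <;> omega

end Knot

/-! ## Sanity checks (`decide`) -/

/-- Sanity (`decide`): a positive kink on the Hopf link after the point `1`: traversal
`1 → 4 → 5 → 0`. [folklore] -/
example : (hopfLink.insertKink (1 : Fin 4) true 1).next (1 : Fin 6) = (4 : Fin 6) ∧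
    (hopfLink.insertKink (1 : Fin 4) true 1).next (4 : Fin 6) = (5 : Fin 6) ∧
    (hopfLink.insertKink (1 : Fin 4) true 1).next (5 : Fin 6) = (0 : Fin 6) := by
  decide

/-- Sanity (`decide`): `(unknots 1).insertKinkFree 1` has the successor and passages of the image
of the knot tower's `GaussDiagram.kink 1` (chord `0 → 1`, `next = finRotate 2`) and no free
circle — the `Ω1` move on the EMPTY knot diagram, invisible to `ofGaussDiagram`. [folklore] -/
example : ((unknots 1).insertKinkFree 1).next = (ofGaussDiagram (GaussDiagram.kink 1)).next ∧
    ((unknots 1).insertKinkFree 1).overPos = (ofGaussDiagram (GaussDiagram.kink 1)).overPos ∧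
    ((unknots 1).insertKinkFree 1).underPos = (ofGaussDiagram (GaussDiagram.kink 1)).underPos ∧
    ((unknots 1).insertKinkFree 1).free = 0 := by
  decide

/-- Sanity (`decide`): an anti-parallel bigon on the Hopf link between the arcs leaving `1`
(over-strand) and `2` (under-strand), a four-crossing diagram: `1 → 4 → 6 → 0`,
`2 → 7 → 5 → 3`. [folklore] -/
example : (hopfLink.insertBigon (1 : Fin 4) (2 : Fin 4) false 1).next (1 : Fin 8) = (4 : Fin 8) ∧
    (hopfLink.insertBigon (1 : Fin 4) (2 : Fin 4) false 1).next (4 : Fin 8) = (6 : Fin 8) ∧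
    (hopfLink.insertBigon (1 : Fin 4) (2 : Fin 4) false 1).next (2 : Fin 8) = (7 : Fin 8) ∧
    (hopfLink.insertBigon (1 : Fin 4) (2 : Fin 4) false 1).next (7 : Fin 8) = (5 : Fin 8) := by
  decide

end LinkGaussDiagram

end Literature.Topology.FourManifolds

end
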